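import Mathlib.Data.List.Chain
import Mathlib.Logic.Relation
import HarnessLib

/-!
# Venture HSemireg — a closed walk through a node lives on the node's core

Elementary bookkeeping behind the «CORE LEMMA» of the computation cell `pub-hsemireg`
(seat w1-aut-1, `widen/W1/HONESTWORD-w1aut1.md` §1b; tool `w1aut1/ldc/cx2fork/core.py`;
TABLE-W1 rows W1AUT-35/35b). There, a first-order cancelling word through a copy `x` of a
letter is read as a CLOSED WALK through `x` in a «potential graph» whose step relation `R`
(arcs allowed by a scope: a window or a placement range) is the same for the differential
components and for the free leaf; the observation used is that every node of such a walk is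
both reachable from `x` and reaches `x` — it lies on the CORE of `x` — so that (i) the closed
walks through `x` are exactly the closed walks of the relation restricted to the core, and
(ii) a SUB-SCOPE that still allows every core node has exactly the same closed walks through
`x`, hence the same verdict for every instrument that is a function of that set of walks.

Walks are lists related consecutively by an arbitrary relation `R` (`List.IsChain R`); a closed
walk through `x` is a chain of the shape `x :: (w ++ [x])`. Reachability is
`Relation.ReflTransGen R`.

* `reach_of_mem`, `reaches_of_mem`, `mem_core_of_mem` — every node of a closed walk through `x`
  is reachable from `x` and reaches `x` (the «core», kept inline as this conjunction — no named
  predicate);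
* `isChain_restrict_core` / `isChain_iff_restrict_core` — (i);
* `isChain_iff_of_core_subset` — (ii): if `R' a b ↔ R a b ∧ S a ∧ S b` (the sub-scope `S`) and
  the core of `x` for `R` is contained in `S`, the closed `R`-walks and the closed `R'`-walks
  through `x` coincide;
* `isChain_mono_scope` — the trivial direction: a sub-relation has fewer walks.

HONEST FRAMING. Order/graph bookkeeping on finite lists only; the Lean index of one step of a
NECESSARY-condition sieve used by the cell. No sheaf, complex, abelian variety or semiregularity
map appears; nothing here says that HC, HC_CM or HC_AV holds, and nothing here is a new case of
anything.
-/

namespace Summit.Ventures.HSemireg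

namespace ClosedWalkCore

open Relation

variable {N : Type*}

/-- Every node of an `R`-chain starting at `s` is reachable from `s`. -/
theorem reach_of_mem {R : N → N → Prop} {s : N} {l : List N} (hl : List.IsChain R (s :: l)) :
    ∀ y ∈ s :: l, ReflTransGen R s y :=
  hl.induction (fun y => ReflTransGen R s y) _ (fun _ _ hab ha => ha.tail hab)
    (fun _ => ReflTransGen.refl)

/-- Every node of an `R`-chain ending at `t` reaches `t`. -/
theorem reaches_of_mem {R : N → N → Prop} {l : List N} {t : N}
    (hl : List.IsChain R (l ++ [t])) : ∀ y ∈ l ++ [t], ReflTransGen R y t :=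
  hl.backwards_induction (fun y => ReflTransGen R y t) _ (fun _ _ hab hb => ReflTransGen.head hab hb)
    (fun _ => by simpa using (ReflTransGen.refl : ReflTransGen R t t))

/-- **Every node of a closed walk through `x` lies on the core of `x`** (is reachable from `x`
and reaches `x`; the core is written inline as this conjunction throughout). -/
theorem mem_core_of_mem {R : N → N → Prop} {x : N} {w : List N}
    (hw : List.IsChain R (x :: (w ++ [x]))) :
    ∀ y ∈ x :: (w ++ [x]), ReflTransGen R x y ∧ ReflTransGen R y x := by
  intro y hy
  refine ⟨reach_of_mem hw y hy, ?_⟩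
  have hw' : List.IsChain R ((x :: w) ++ [x]) := hw
  exact reaches_of_mem hw' y (by simpa using hy)

/-- (i) A closed walk through `x` is a closed walk of the relation RESTRICTED to the core. -/
theorem isChain_restrict_core {R : N → N → Prop} {x : N} {w : List N}
    (hw : List.IsChain R (x :: (w ++ [x]))) :
    List.IsChain (fun a b => R a b ∧ (ReflTransGen R x a ∧ ReflTransGen R a x) ∧
      (ReflTransGen R x b ∧ ReflTransGen R b x)) (x :: (w ++ [x])) :=
  hw.imp_of_mem_imp fun a b ha hb hab => ⟨hab, mem_core_of_mem hw a ha, mem_core_of_mem hw b hb⟩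

/-- (i), as an equivalence: the closed walks through `x` for `R` and for `R` restricted to the
core of `x` are the same lists. -/
theorem isChain_iff_restrict_core (R : N → N → Prop) (x : N) (w : List N) :
    List.IsChain R (x :: (w ++ [x])) ↔
      List.IsChain (fun a b => R a b ∧ (ReflTransGen R x a ∧ ReflTransGen R a x) ∧
        (ReflTransGen R x b ∧ ReflTransGen R b x)) (x :: (w ++ [x])) :=
  ⟨isChain_restrict_core, fun h => h.imp fun _ _ hab => hab.1⟩

/-- The trivial direction of (ii): a sub-relation has fewer walks (sub-scope ⇒ subset of the
closed walks). -/
theorem isChain_mono_scope {R R' : N → N → Prop} (hRR' : ∀ a b, R' a b → R a b) {l : List N}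
    (hl : List.IsChain R' l) : List.IsChain R l :=
  hl.imp fun a b hab => hRR' a b hab

/-- **(ii) Equal closed walks on a sub-scope containing the core.** If `R'` is `R` restricted to
a node set `S` (`R' a b ↔ R a b ∧ S a ∧ S b`) and every core node of `x` for `R` lies in `S`,
then the closed `R`-walks through `x` are exactly the closed `R'`-walks through `x`. In the
cell's use: `R` = the arcs of the ±8 window, `S` = the placement `[−1,1]`, and the computed core
of the tested letter sits at offsets `−1, 0, +1`; every word set, and every verdict computed from
it, is then the same for the window and for the placement. -/
theorem isChain_iff_of_core_subset {R R' : N → N → Prop} {S : N → Prop} {x : N}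
    (hR' : ∀ a b, R' a b ↔ R a b ∧ S a ∧ S b)
    (hcore : ∀ y, ReflTransGen R x y → ReflTransGen R y x → S y) (w : List N) :
    List.IsChain R (x :: (w ++ [x])) ↔ List.IsChain R' (x :: (w ++ [x])) := by
  constructor
  · intro hw
    exact (isChain_restrict_core hw).imp fun a b hab =>
      (hR' a b).mpr ⟨hab.1, hcore a hab.2.1.1 hab.2.1.2, hcore b hab.2.2.1 hab.2.2.2⟩
  · intro hw'
    exact hw'.imp fun a b hab => ((hR' a b).mp hab).1

/-- Corollary used for the record: under the hypotheses of `isChain_iff_of_core_subset`, any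
property of «the closed walks through `x`» — a verdict read off that set — holds for `R` iff it
holds for `R'`, here in the form «no closed walk through `x` satisfies `P`». -/
theorem no_closedWalk_iff_of_core_subset {R R' : N → N → Prop} {S : N → Prop} {x : N}
    (hR' : ∀ a b, R' a b ↔ R a b ∧ S a ∧ S b)
    (hcore : ∀ y, ReflTransGen R x y → ReflTransGen R y x → S y) (P : List N → Prop) :
    (∀ w, List.IsChain R (x :: (w ++ [x])) → ¬ P w) ↔
      (∀ w, List.IsChain R' (x :: (w ++ [x])) → ¬ P w) := by
  constructor
  · intro h w hw; exact h w ((isChain_iff_of_core_subset hR' hcore w).mpr hw)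
  · intro h w hw; exact h w ((isChain_iff_of_core_subset hR' hcore w).mp hw)

end ClosedWalkCore

end Summit.Ventures.HSemireg
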